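import Mathlib
import Literature.Computability.AlgebraicComplexity.PermanentIrreducible
import Literature.Computability.AlgebraicComplexity.StandardFamiliesProofs
import Summits.ValiantsHypothesis.ValiantsHypothesis.Theorems.DivisionGapPerCofactorDegreeReductionStubAdditiveCreation
import Summits.ValiantsHypothesis.ValiantsHypothesis.Theorems.DivisionGapPerCofactorDegreeReductionStubRelationComponents

/-!
# Crux `DivisionGap.PerCofactorDegreeReduction` (stmt-ValiantsHypothesis-15046), line `Sketch` —
# stub `stub_weightCollapseSterile`: positively proportional weight classes admit no creation

**Theorem (`stub_weightCollapseSterile`).** Let `n ≥ 1` and let `L₀, …, L_{r-1} ∈ ℝ[x_ij]`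
(`n × n` variables) be forms of degrees `e_i`, none divisible by `per_n`, such that any two
monomials `L^α = ∏ L_i^{α_i}`, `L^β` of equal weight `Σ α_i e_i = Σ β_i e_i` are congruent modulo
`per_n` up to a POSITIVE real constant: `per_n ∣ L^α - ρ L^β`, `ρ > 0`.  Then no nonzero
`G ∈ ℝ≥0[z_0, …, z_{r-1}]` has `per_n ∣ G(L)` (reading `G` over `ℝ`): such gate systems are sterile.

## Proof

Suppose `per_n ∣ G(L)` and pick a monomial `z^{m₀}` of `G`, of weight `D₀ = Σ m₀_i e_i`.
* *One weight suffices.* Substituting the forms `L_i` (degrees `e_i`) intertwines weighted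
  homogeneous components (weights `e`) with homogeneous components
  (`RelationComponents.homogeneousComponent_aeval`), and a form divides every homogeneous
  component of each of its multiples (`RelationComponents.dvd_homogeneousComponent_mul`, `per_n` is
  a form of degree `n`, `perPoly_isHomogeneous`).  Hence `per_n ∣ H(L)` for the weight-`D₀` part
  `H` of `G` (over `ℝ`); the coefficients of `H` are those of `G` on the monomials of weight `D₀`
  (nonnegative, and `H ∋ z^{m₀}` is nonzero) and `0` elsewhere.
* *Collapse.* For every monomial `z^m` of `H` the hypothesis gives `ρ_m > 0` with
  `per_n ∣ L^m - ρ_m L^{m₀}`, so `H(L) = Σ_m H_m L^m ≡ c · L^{m₀}` modulo `per_n` with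
  `c = Σ_m H_m ρ_m > 0` (every summand is positive and the sum is nonempty).
* *Primality.* `per_n` is prime (`AdditiveCreation.perPoly_prime`) and `c ≠ 0` is a unit, so
  `per_n ∣ L^{m₀} = ∏ L_i^{m₀ i}` forces `per_n ∣ L_i` for some `i` — a contradiction.
-/

noncomputable section

-- `Summit.ValiantsHypothesis.ValiantsHypothesis.…` is the tree's mandated single-conjunct layout
-- (Problem = Summit), so the duplicated namespace component is intended.
set_option linter.dupNamespace false

namespace Summit.ValiantsHypothesis.ValiantsHypothesis.Theorems.DivisionGap.PerCofactorDegreeReduction.WeightCollapseSterile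

open MvPolynomial Literature.Computability.AlgebraicComplexity
open Summit.ValiantsHypothesis.ValiantsHypothesis.Theorems.DivisionGap.PerCofactorDegreeReduction.AdditiveCreation
  (perPoly_prime)
open Summit.ValiantsHypothesis.ValiantsHypothesis.Theorems.DivisionGap.PerCofactorDegreeReduction.RelationComponents
  (homogeneousComponent_aeval dvd_homogeneousComponent_mul)
open scoped NNReal BigOperators

/-! ### Two bookkeeping identities -/

/-- The weight of an exponent vector on `Fin r` is the full sum `Σ i, m i · e i`. [folklore] -/
theorem weight_eq_sum {r : ℕ} (e : Fin r → ℕ) (m : Fin r →₀ ℕ) :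
    Finsupp.weight e m = ∑ i, m i * e i := by
  rw [Finsupp.weight_apply, Finsupp.sum_fintype]
  · simp only [smul_eq_mul]
  · exact fun _ => zero_smul ℕ _

/-- Substitution expanded over the support: `p(f) = Σ_{m ∈ supp p} p_m · ∏ i, (f i)^(m i)`.
[folklore] -/
theorem aeval_eq_sum {σ τ : Type*} [Fintype σ] (f : σ → MvPolynomial τ ℝ)
    (p : MvPolynomial σ ℝ) :
    aeval f p = ∑ m ∈ p.support, C (coeff m p) * ∏ i, f i ^ m i := by
  conv_lhs => rw [p.as_sum, map_sum]
  refine Finset.sum_congr rfl fun m _ => ?_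
  rw [aeval_monomial, algebraMap_eq, Finsupp.prod_fintype _ _ fun _ => pow_zero _]

/-! ### The stub -/

/-- **Positively proportional weight classes admit no creation.** Let `L_i ∉ (per_n)` be real
forms of degrees `e_i` (`n ≥ 1`) such that any two monomials `L^α, L^β` of equal weight are
congruent up to a POSITIVE constant modulo `per_n`.  Then no nonzero nonnegative `G ∈ ℝ≥0[z]` has
`per_n ∣ G(L)`. [folklore] -/
theorem stub_weightCollapseSterile (n r : ℕ) (hn : 1 ≤ n) (e : Fin r → ℕ)
    (L : Fin r → MvPolynomial (Fin n × Fin n) ℝ)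
    (hL : ∀ i, ¬ perPoly (Fin n) ℝ ∣ L i) (hLh : ∀ i, (L i).IsHomogeneous (e i))
    (hprop : ∀ α β : Fin r → ℕ, ∑ i, α i * e i = ∑ i, β i * e i →
      ∃ ρ : ℝ, 0 < ρ ∧ perPoly (Fin n) ℝ ∣ (∏ i, L i ^ α i) - C ρ * ∏ i, L i ^ β i)
    (G : MvPolynomial (Fin r) ℝ≥0) (hG : G ≠ 0) :
    ¬ perPoly (Fin n) ℝ ∣ MvPolynomial.aeval L (MvPolynomial.map NNReal.toRealHom G) := by
  intro hdvd
  have hprime : Prime (perPoly (Fin n) ℝ) := perPoly_prime hn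
  have hPhom : (perPoly (Fin n) ℝ).IsHomogeneous n := by
    simpa using (perPoly_isHomogeneous (n := Fin n) (k := ℝ))
  -- a monomial `z^{m₀}` of `G`; its weight `D₀ = weight e m₀` is the degree we look at
  obtain ⟨m₀, hm₀⟩ := MvPolynomial.support_nonempty.mpr hG
  -- the weight-`D₀` part `H` of `G`, read over `ℝ`
  set H : MvPolynomial (Fin r) ℝ := weightedHomogeneousComponent e (Finsupp.weight e m₀)
    (MvPolynomial.map NNReal.toRealHom G) with hH
  -- Step 1: `per_n ∣ H(L)`, the degree-`D₀` homogeneous component of `G(L)`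
  have h1 : perPoly (Fin n) ℝ ∣ aeval L H := by
    obtain ⟨Q, hQ⟩ := hdvd
    rw [hH, ← homogeneousComponent_aeval e hLh, hQ]
    exact dvd_homogeneousComponent_mul hPhom Q _
  -- the coefficients of `H`
  have hHc : ∀ m, coeff m H =
      if Finsupp.weight e m = Finsupp.weight e m₀ then ((coeff m G : ℝ≥0) : ℝ) else 0 := by
    intro m
    rw [hH, coeff_weightedHomogeneousComponent, coeff_map, NNReal.coe_toRealHom]
  have hcoeff : ∀ m ∈ H.support,
      Finsupp.weight e m = Finsupp.weight e m₀ ∧ coeff m H = ((coeff m G : ℝ≥0) : ℝ) := by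
    intro m hm
    have h := mem_support_iff.mp hm
    rw [hHc] at h ⊢
    by_cases hw : Finsupp.weight e m = Finsupp.weight e m₀
    · rw [if_pos hw]
      exact ⟨hw, rfl⟩
    · rw [if_neg hw] at h
      exact absurd rfl h
  have hpos : ∀ m ∈ H.support, 0 < coeff m H := by
    intro m hm
    have h := mem_support_iff.mp hm
    rw [(hcoeff m hm).2] at h ⊢
    exact lt_of_le_of_ne (NNReal.coe_nonneg _) h.symm
  have hm₀H : m₀ ∈ H.support := by
    rw [mem_support_iff, hHc, if_pos rfl, NNReal.coe_ne_zero]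
    exact mem_support_iff.mp hm₀
  -- Step 2: the proportionality constants `ρ_m > 0`, `per_n ∣ L^m - ρ_m L^{m₀}`
  have key : ∀ m ∈ H.support, ∃ ρ : ℝ, 0 < ρ ∧
      perPoly (Fin n) ℝ ∣ (∏ i, L i ^ m i) - C ρ * ∏ i, L i ^ m₀ i := by
    intro m hm
    refine hprop m m₀ ?_
    have hw := (hcoeff m hm).1
    rwa [weight_eq_sum, weight_eq_sum] at hw
  choose! ρ hρpos hρdvd using key
  -- Step 3: collapse — `H(L) ≡ c · L^{m₀}` modulo `per_n`, with `c = Σ_m H_m ρ_m > 0`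
  set c : ℝ := ∑ m ∈ H.support, coeff m H * ρ m with hc
  have hcpos : 0 < c :=
    Finset.sum_pos (fun m hm => mul_pos (hpos m hm) (hρpos m hm)) ⟨m₀, hm₀H⟩
  have h2 : perPoly (Fin n) ℝ ∣ C c * ∏ i, L i ^ m₀ i := by
    have h3 : perPoly (Fin n) ℝ ∣ ∑ m ∈ H.support,
        C (coeff m H) * ((∏ i, L i ^ m i) - C (ρ m) * ∏ i, L i ^ m₀ i) :=
      Finset.dvd_sum fun m hm => dvd_mul_of_dvd_right (hρdvd m hm) _
    have h4 : (∑ m ∈ H.support, C (coeff m H) * ∏ i, L i ^ m i) -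
        ∑ m ∈ H.support, C (coeff m H) * ((∏ i, L i ^ m i) - C (ρ m) * ∏ i, L i ^ m₀ i) =
        C c * ∏ i, L i ^ m₀ i := by
      rw [← Finset.sum_sub_distrib, hc, map_sum, Finset.sum_mul]
      refine Finset.sum_congr rfl fun m _ => ?_
      rw [mul_sub, sub_sub_cancel, map_mul, mul_assoc]
    rw [← h4, ← aeval_eq_sum]
    exact dvd_sub h1 h3
  -- Step 4: primality — `c` is a unit and `per_n ∤ L_i`
  rcases hprime.dvd_or_dvd h2 with h5 | h5
  · exact hprime.not_unit (isUnit_of_dvd_unit h5 ((isUnit_iff_ne_zero.mpr hcpos.ne').map C))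
  · obtain ⟨i, -, hi⟩ := hprime.exists_mem_finset_dvd h5
    exact hL i (hprime.dvd_of_dvd_pow hi)

end Summit.ValiantsHypothesis.ValiantsHypothesis.Theorems.DivisionGap.PerCofactorDegreeReduction.WeightCollapseSterile

end
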